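import Literature.MathematicalPhysics.StatisticalMechanics.LocalMatchingCompactness

/-!
# Crux `PeriodicWindows` (stmt-AtomisticToContinuum-3240), line `Sketch` — stub `stub_goodLimit`, B

Limit infrastructure for the compactness step E0a (`stub_goodLimit`) of the lead skeleton
`PeriodicWindowsSketch`. The setting of parts B and C: a sequence of finite configurations
`y k : Fin (nn k) → ℝ³` with centres `y k (i₀ k)`, window radii `R k → ∞`, tolerances `η k → 0`,
normals `nrm k → nlim`, ONE linear isometry `B` whose third coordinate is the height along `nlim`
(`(B z) 2 = ⟪z, nlim⟫`), and a `19/20`-separated set `X ⊆ ℝ³` that is the local two-way-matching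
limit of the rotated recentred windows
`Ys k = {B (y k j - y k (i₀ k)) | dist (y k j) (y k (i₀ k)) ≤ R k}` (`BallMatch`, eventually in `k`,
at every radius and tolerance). We prove:

* `gl_mem_of_forall_exists_dist_le` — a `19/20`-separated set contains every point it approximates;
* `gl_eventually_eq_of_abs_sub_le` (+ finite-family versions) — for small `ε > 0`, reals of a finite
  family that are `10ε`-close to a target are equal to it;
* `gl_abs_height_sub_sub_inner_le` — heights of `B`-images versus offsets along an approximate
  normal;
* `gl_eventually_approx` — a point of `X` has, eventually in `k`, a half-window particle whose image
  is `ε`-close to it;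
* `gl_zero_mem_limit` — `0 ∈ X`;
* `gl_gap_clause` — heights of `X` are pairwise equal or `≥ 19/25` apart, from the per-window
  dichotomy "offsets along `nrm k` are `≤ 2η` or `≥ 19/25 - 2η`";
* `gl_sharp_clause` — same-height pairs of `X` closer than `1` are at distance `lim L`, from the
  per-window sharpness "a neighbour closer than `19/25 - 2η` along `nrm k` has bond `η`-close to
  `L k`".
-/

noncomputable section

namespace Summit.AtomisticToContinuum.Crystallization.Theorems.PeriodicWindowsSketch

open Literature.MathematicalPhysics.StatisticalMechanics Filter Metric Topology

/-! ## Elementary tools -/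

/-- Coordinates are `1`-Lipschitz: `|p l - q l| ≤ dist p q` in `ℝ³`. -/
theorem gl_coord_sub_le_dist (p q : EuclideanSpace ℝ (Fin 3)) (l : Fin 3) :
    |p l - q l| ≤ dist p q := by
  rw [← Real.dist_eq]
  exact PiLp.dist_apply_le p q l

/-- Recentring by a common vector and applying a linear isometry preserve distances. -/
theorem gl_dist_map_sub_sub (B : EuclideanSpace ℝ (Fin 3) ≃ₗᵢ[ℝ] EuclideanSpace ℝ (Fin 3))
    (u v w : EuclideanSpace ℝ (Fin 3)) :
    dist (B (u - w)) (B (v - w)) = dist u v := by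
  rw [B.dist_map, dist_sub_right]

/-- Closest-point principle: a `19/20`-separated set `X` contains every point `c` such that for
every `ε > 0` some point of `X` lies within `ε` of `c` (the finitely many points of `X` in
`B̄(c, 1)` contain a closest one, which must be `c`). -/
theorem gl_mem_of_forall_exists_dist_le {X : Set (EuclideanSpace ℝ (Fin 3))}
    (hsep : ∀ p ∈ X, ∀ q ∈ X, p ≠ q → (19 : ℝ) / 20 ≤ dist p q) (c : EuclideanSpace ℝ (Fin 3))
    (h : ∀ ε : ℝ, 0 < ε → ∃ s ∈ X, dist s c ≤ ε) : c ∈ X := by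
  have hfin : (X ∩ closedBall c 1).Finite :=
    finite_of_forall_le_dist_of_subset_closedBall (by norm_num : (0 : ℝ) < 19 / 20)
      (fun p hp q hq hpq => hsep p hp.1 q hq.1 hpq) Set.inter_subset_right
  obtain ⟨s₁, hs₁, hs₁c⟩ := h 1 one_pos
  have hne : (X ∩ closedBall c 1).Nonempty := ⟨s₁, hs₁, mem_closedBall.2 hs₁c⟩
  obtain ⟨s₀, hs₀, hmin⟩ := Set.exists_min_image _ (fun s => dist s c) hfin hne
  have hs₀c : dist s₀ c ≤ 0 := by
    refine le_of_forall_pos_le_add fun ε hε => ?_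
    obtain ⟨s, hs, hsc⟩ := h (min ε 1) (lt_min hε one_pos)
    have hsS : s ∈ X ∩ closedBall c 1 := ⟨hs, mem_closedBall.2 (hsc.trans (min_le_right ε 1))⟩
    calc dist s₀ c ≤ dist s c := hmin s hsS
      _ ≤ min ε 1 := hsc
      _ ≤ 0 + ε := by rw [zero_add]; exact min_le_left ε 1
  have : s₀ = c := dist_le_zero.1 hs₀c
  exact this ▸ hs₀.1

/-- Robustness of an equality of reals under small perturbations: for all small `ε > 0`, if
`|u - v| ≤ 10ε` then `u = v` (trivial if `u = v`, vacuous for `10ε < |u - v|` otherwise). -/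
theorem gl_eventually_eq_of_abs_sub_le (u v : ℝ) :
    ∀ᶠ ε in 𝓝[>] (0 : ℝ), |u - v| ≤ 10 * ε → u = v := by
  by_cases huv : u = v
  · exact Eventually.of_forall fun _ _ => huv
  · have hd : 0 < |u - v| := abs_pos.2 (sub_ne_zero.2 huv)
    have ht : Tendsto (fun ε : ℝ => 10 * ε) (𝓝[>] 0) (𝓝 (10 * 0)) :=
      ((continuous_const.mul continuous_id).tendsto 0).mono_left nhdsWithin_le_nhds
    rw [mul_zero] at ht
    filter_upwards [ht.eventually (eventually_lt_nhds hd)] with ε hε h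
    exact absurd h (not_le.2 hε)

/-- Finite-family version of `gl_eventually_eq_of_abs_sub_le` with a fixed target. -/
theorem gl_eventually_forall_eq_of_abs_sub_le {ι : Type*} {T : Set ι} (hT : T.Finite) (f : ι → ℝ)
    (v : ℝ) : ∀ᶠ ε in 𝓝[>] (0 : ℝ), ∀ t ∈ T, |f t - v| ≤ 10 * ε → f t = v :=
  hT.eventually_all.2 fun t _ => gl_eventually_eq_of_abs_sub_le (f t) v

/-- Finite-family version of `gl_eventually_eq_of_abs_sub_le` for pairs. -/
theorem gl_eventually_forall₂_eq_of_abs_sub_le {ι : Type*} {T : Set ι} (hT : T.Finite) (f : ι → ℝ) :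
    ∀ᶠ ε in 𝓝[>] (0 : ℝ), ∀ t ∈ T, ∀ t' ∈ T, |f t - f t'| ≤ 10 * ε → f t = f t' :=
  hT.eventually_all.2 fun t _ => hT.eventually_all.2 fun t' _ =>
    gl_eventually_eq_of_abs_sub_le (f t) (f t')

/-- Heights after the rotation `B` (third coordinate `=` height along `nlim`) versus offsets along
an approximate normal `m`: the discrepancy is at most `‖u - w‖ · ‖nlim - m‖`. -/
theorem gl_abs_height_sub_sub_inner_le
    {B : EuclideanSpace ℝ (Fin 3) ≃ₗᵢ[ℝ] EuclideanSpace ℝ (Fin 3)} {nlim : EuclideanSpace ℝ (Fin 3)}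
    (hB : ∀ z : EuclideanSpace ℝ (Fin 3), (B z) 2 = inner ℝ z nlim)
    (m u w : EuclideanSpace ℝ (Fin 3)) :
    |(B u) 2 - (B w) 2 - inner ℝ (u - w) m| ≤ ‖u - w‖ * ‖nlim - m‖ := by
  have hid : (B u) 2 - (B w) 2 - inner ℝ (u - w) m = inner ℝ (u - w) (nlim - m) := by
    rw [hB, hB, ← inner_sub_left, ← inner_sub_right]
  rw [hid]
  exact abs_real_inner_le_norm _ _

/-- The norm error `‖nrm k - nlim‖ · M` tends to `0`. -/
theorem gl_tendsto_norm_sub_mul {nrm : ℕ → EuclideanSpace ℝ (Fin 3)}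
    {nlim : EuclideanSpace ℝ (Fin 3)} (hnrm : Tendsto nrm atTop (𝓝 nlim)) (M : ℝ) :
    Tendsto (fun k => ‖nrm k - nlim‖ * M) atTop (𝓝 0) := by
  have := (tendsto_iff_norm_sub_tendsto_zero.1 hnrm).mul_const M
  rwa [zero_mul] at this

/-! ## Approximants -/

/-- A point `p` of the limit `X` has, eventually in `k`, a HALF-window particle `J` whose rotated
recentred position is `ε`-close to `p` (first matching clause at radius `‖p‖`, and `R k → ∞`). -/
theorem gl_eventually_approx {nn : ℕ → ℕ} {y : (k : ℕ) → Fin (nn k) → EuclideanSpace ℝ (Fin 3)}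
    {i₀ : (k : ℕ) → Fin (nn k)}
    {R : ℕ → ℝ} (hR : Tendsto R atTop atTop)
    {B : EuclideanSpace ℝ (Fin 3) ≃ₗᵢ[ℝ] EuclideanSpace ℝ (Fin 3)}
    {X : Set (EuclideanSpace ℝ (Fin 3))}
    (hmatch : ∀ r ε : ℝ, 0 < ε → ∀ᶠ k in atTop, BallMatch ε r 0
      {p | ∃ j : Fin (nn k), dist (y k j) (y k (i₀ k)) ≤ R k ∧ p = B (y k j - y k (i₀ k))} X)
    {p : EuclideanSpace ℝ (Fin 3)} (hp : p ∈ X) {ε : ℝ} (hε : 0 < ε) :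
    ∀ᶠ k in atTop, ∃ J : Fin (nn k), dist (y k J) (y k (i₀ k)) ≤ R k / 2 ∧
      dist (B (y k J - y k (i₀ k))) p ≤ ε := by
  filter_upwards [hmatch ‖p‖ ε hε, hR.eventually_ge_atTop (2 * (‖p‖ + ε))] with k hBM hk
  obtain ⟨x, ⟨J, -, rfl⟩, hx⟩ := hBM.1 p hp (dist_zero_right p).le
  refine ⟨J, ?_, hx⟩
  have h1 : dist (y k J) (y k (i₀ k)) = ‖B (y k J - y k (i₀ k))‖ := by
    rw [B.norm_map, dist_eq_norm]
  have h2 : ‖B (y k J - y k (i₀ k))‖ ≤ ‖p‖ + ε :=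
    calc ‖B (y k J - y k (i₀ k))‖ = dist (B (y k J - y k (i₀ k))) 0 := (dist_zero_right _).symm
      _ ≤ dist (B (y k J - y k (i₀ k))) p + dist p 0 := dist_triangle _ _ _
      _ ≤ ε + ‖p‖ := add_le_add hx (dist_zero_right p).le
      _ = ‖p‖ + ε := add_comm _ _
  rw [h1]
  linarith

/-! ## `0 ∈ X` -/

/-- The origin belongs to the limit: it is the image of the centre in every window, so the second
matching clause approximates it by points of `X` to any accuracy, and `X` is separated. -/
theorem gl_zero_mem_limit {nn : ℕ → ℕ} {y : (k : ℕ) → Fin (nn k) → EuclideanSpace ℝ (Fin 3)}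
    {i₀ : (k : ℕ) → Fin (nn k)}
    {R : ℕ → ℝ} (hR : Tendsto R atTop atTop)
    {B : EuclideanSpace ℝ (Fin 3) ≃ₗᵢ[ℝ] EuclideanSpace ℝ (Fin 3)}
    {X : Set (EuclideanSpace ℝ (Fin 3))}
    (hsepX : ∀ p ∈ X, ∀ q ∈ X, p ≠ q → (19 : ℝ) / 20 ≤ dist p q)
    (hmatch : ∀ r ε : ℝ, 0 < ε → ∀ᶠ k in atTop, BallMatch ε r 0
      {p | ∃ j : Fin (nn k), dist (y k j) (y k (i₀ k)) ≤ R k ∧ p = B (y k j - y k (i₀ k))} X) :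
    (0 : EuclideanSpace ℝ (Fin 3)) ∈ X := by
  refine gl_mem_of_forall_exists_dist_le hsepX 0 fun ε hε => ?_
  obtain ⟨k, hBM, hk⟩ := ((hmatch 0 ε hε).and (hR.eventually_ge_atTop 0)).exists
  have h0 : (0 : EuclideanSpace ℝ (Fin 3)) ∈
      {p | ∃ j : Fin (nn k), dist (y k j) (y k (i₀ k)) ≤ R k ∧ p = B (y k j - y k (i₀ k))} :=
    ⟨i₀ k, by rw [dist_self]; exact hk, by rw [sub_self, map_zero]⟩
  obtain ⟨s, hs, hs0⟩ := hBM.2 0 h0 (dist_self (0 : EuclideanSpace ℝ (Fin 3))).le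
  exact ⟨s, hs, by rwa [dist_comm]⟩

/-! ## Heights of the limit are equal or `≥ 19/25` apart -/

/-- **Gap clause.** If in every window two window particles are either `2η k`-close or at least
`19/25 - 2η k` apart along `nrm k`, then two points of `X` have equal heights or heights at least
`19/25` apart. (Approximate `p, q` by particle images; their height difference is the offset
along `nrm k` up to `3ε`; both alternatives contradict `0 < |q 2 - p 2| < 19/25` for small `ε`.) -/
theorem gl_gap_clause {nn : ℕ → ℕ} {y : (k : ℕ) → Fin (nn k) → EuclideanSpace ℝ (Fin 3)}
    {i₀ : (k : ℕ) → Fin (nn k)}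
    {R η : ℕ → ℝ} (hR : Tendsto R atTop atTop) (hη : Tendsto η atTop (𝓝 0))
    {nrm : ℕ → EuclideanSpace ℝ (Fin 3)} {nlim : EuclideanSpace ℝ (Fin 3)}
    (hnrm : Tendsto nrm atTop (𝓝 nlim))
    {B : EuclideanSpace ℝ (Fin 3) ≃ₗᵢ[ℝ] EuclideanSpace ℝ (Fin 3)}
    (hB : ∀ z : EuclideanSpace ℝ (Fin 3), (B z) 2 = inner ℝ z nlim)
    {X : Set (EuclideanSpace ℝ (Fin 3))}
    (hmatch : ∀ r ε : ℝ, 0 < ε → ∀ᶠ k in atTop, BallMatch ε r 0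
      {p | ∃ j : Fin (nn k), dist (y k j) (y k (i₀ k)) ≤ R k ∧ p = B (y k j - y k (i₀ k))} X)
    (hgapW : ∀ (k : ℕ) (j j' : Fin (nn k)), dist (y k j) (y k (i₀ k)) ≤ R k →
      dist (y k j') (y k (i₀ k)) ≤ R k →
      |inner ℝ (y k j' - y k j) (nrm k)| ≤ 2 * η k ∨
        19 / 25 - 2 * η k ≤ |inner ℝ (y k j' - y k j) (nrm k)|) :
    ∀ p ∈ X, ∀ q ∈ X, q 2 = p 2 ∨ 19 / 25 ≤ |q 2 - p 2| := by
  intro p hp q hq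
  by_contra hcon
  push Not at hcon
  obtain ⟨hne, hlt⟩ := hcon
  have hd0 : 0 < |q 2 - p 2| := abs_pos.2 (sub_ne_zero.2 hne)
  obtain ⟨ε, hε0, hε1, hε2⟩ : ∃ ε : ℝ, 0 < ε ∧ ε ≤ |q 2 - p 2| / 8 ∧
      ε ≤ (19 / 25 - |q 2 - p 2|) / 8 :=
    ⟨min (|q 2 - p 2| / 8) ((19 / 25 - |q 2 - p 2|) / 8), lt_min (by linarith) (by linarith),
      min_le_left _ _, min_le_right _ _⟩
  obtain ⟨k, ⟨⟨⟨⟨J, hJ, hJp⟩, ⟨J', hJ', hJ'q⟩⟩, hηk⟩, hnk⟩, hRk⟩ :=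
    (((((gl_eventually_approx hR hmatch hp hε0).and (gl_eventually_approx hR hmatch hq hε0)).and
      (hη.eventually (eventually_lt_nhds hε0))).and
      ((gl_tendsto_norm_sub_mul hnrm (‖p‖ + ‖q‖ + 2)).eventually (eventually_lt_nhds hε0))).and
      (hR.eventually_ge_atTop 0)).exists
  have hJR : dist (y k J) (y k (i₀ k)) ≤ R k := hJ.trans (half_le_self hRk)
  have hJ'R : dist (y k J') (y k (i₀ k)) ≤ R k := hJ'.trans (half_le_self hRk)
  have hdiff : y k J' - y k (i₀ k) - (y k J - y k (i₀ k)) = y k J' - y k J := by abel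
  -- the height difference of the two images versus the offset along `nrm k`
  have hh := gl_abs_height_sub_sub_inner_le hB (nrm k) (y k J' - y k (i₀ k)) (y k J - y k (i₀ k))
  rw [hdiff] at hh
  have hnormJJ' : ‖y k J' - y k J‖ ≤ ‖p‖ + ‖q‖ + 2 := by
    have h1 : ‖y k J' - y k J‖ = dist (B (y k J' - y k (i₀ k))) (B (y k J - y k (i₀ k))) := by
      rw [gl_dist_map_sub_sub, dist_eq_norm]
    rw [h1]
    calc dist (B (y k J' - y k (i₀ k))) (B (y k J - y k (i₀ k)))
        ≤ dist (B (y k J' - y k (i₀ k))) q + dist q p + dist p (B (y k J - y k (i₀ k))) :=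
          dist_triangle4 _ _ _ _
      _ ≤ ε + (‖q‖ + ‖p‖) + ε := by
          refine add_le_add (add_le_add hJ'q ?_) (by rwa [dist_comm])
          rw [dist_eq_norm]; exact norm_sub_le _ _
      _ ≤ ‖p‖ + ‖q‖ + 2 := by linarith
  have herr : ‖y k J' - y k J‖ * ‖nlim - nrm k‖ ≤ ε :=
    calc ‖y k J' - y k J‖ * ‖nlim - nrm k‖ ≤ (‖p‖ + ‖q‖ + 2) * ‖nlim - nrm k‖ :=
          mul_le_mul_of_nonneg_right hnormJJ' (norm_nonneg _)
      _ = ‖nrm k - nlim‖ * (‖p‖ + ‖q‖ + 2) := by rw [norm_sub_rev, mul_comm]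
      _ ≤ ε := hnk.le
  have h1 := abs_le.1 ((gl_coord_sub_le_dist (B (y k J - y k (i₀ k))) p 2).trans hJp)
  have h2 := abs_le.1 ((gl_coord_sub_le_dist (B (y k J' - y k (i₀ k))) q 2).trans hJ'q)
  have h3 := abs_le.1 (hh.trans herr)
  rcases hgapW k J J' hJR hJ'R with hsmall | hbig
  · have h4 := abs_le.1 hsmall
    have : |q 2 - p 2| ≤ 5 * ε := by
      rw [abs_le]; constructor <;> linarith
    linarith
  · have : |inner ℝ (y k J' - y k J) (nrm k)| ≤ |q 2 - p 2| + 3 * ε := by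
      rw [abs_le]
      have := neg_abs_le (q 2 - p 2)
      have := le_abs_self (q 2 - p 2)
      constructor <;> linarith
    linarith

/-! ## Same-height pairs closer than `1` are at distance `lim L` -/

/-- **Sharpness clause.** If in every window a neighbour (distance `≤ 1`, distinct) of a
half-window particle that is closer than `19/25 - 2η k` along `nrm k` has bond length `η k`-close
to `L k`, and `L k → Llim`, then two distinct points of `X` at the same height and distance `< 1`
are at distance exactly `Llim`. -/
theorem gl_sharp_clause {nn : ℕ → ℕ} {y : (k : ℕ) → Fin (nn k) → EuclideanSpace ℝ (Fin 3)}
    {i₀ : (k : ℕ) → Fin (nn k)}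
    {R η : ℕ → ℝ} (hR : Tendsto R atTop atTop) (hη : Tendsto η atTop (𝓝 0))
    {nrm : ℕ → EuclideanSpace ℝ (Fin 3)} {nlim : EuclideanSpace ℝ (Fin 3)}
    (hnrm : Tendsto nrm atTop (𝓝 nlim))
    {B : EuclideanSpace ℝ (Fin 3) ≃ₗᵢ[ℝ] EuclideanSpace ℝ (Fin 3)}
    (hB : ∀ z : EuclideanSpace ℝ (Fin 3), (B z) 2 = inner ℝ z nlim)
    {X : Set (EuclideanSpace ℝ (Fin 3))}
    (hmatch : ∀ r ε : ℝ, 0 < ε → ∀ᶠ k in atTop, BallMatch ε r 0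
      {p | ∃ j : Fin (nn k), dist (y k j) (y k (i₀ k)) ≤ R k ∧ p = B (y k j - y k (i₀ k))} X)
    {L : ℕ → ℝ} {Llim : ℝ} (hL : Tendsto L atTop (𝓝 Llim))
    (hsharpW : ∀ (k : ℕ) (j j' : Fin (nn k)), dist (y k j) (y k (i₀ k)) ≤ R k / 2 →
      dist (y k j') (y k (i₀ k)) ≤ R k → j' ≠ j → dist (y k j) (y k j') ≤ 1 →
      |inner ℝ (y k j' - y k j) (nrm k)| < 19 / 25 - 2 * η k →
      |dist (y k j) (y k j') - L k| ≤ η k) :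
    ∀ p ∈ X, ∀ q ∈ X, p ≠ q → dist p q < 1 → q 2 = p 2 → dist p q = Llim := by
  intro p hp q hq hpq hpq1 hqp
  have hpq0 : 0 < dist p q := dist_pos.2 hpq
  refine eq_of_forall_dist_le fun ε' hε' => ?_
  -- a working tolerance `ε ≤ ε'/4` also small against `dist p q`, `1 - dist p q` and `19/25`
  obtain ⟨ε, hε0, hε1, hε2, hε3, hε4⟩ : ∃ ε : ℝ, 0 < ε ∧ ε ≤ ε' / 4 ∧ ε ≤ dist p q / 4 ∧
      ε ≤ (1 - dist p q) / 2 ∧ ε ≤ 1 / 10 :=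
    ⟨min (min (ε' / 4) (dist p q / 4)) (min ((1 - dist p q) / 2) (1 / 10)),
      lt_min (lt_min (by linarith) (by linarith)) (lt_min (by linarith) (by norm_num)),
      (min_le_left _ _).trans (min_le_left _ _), (min_le_left _ _).trans (min_le_right _ _),
      (min_le_right _ _).trans (min_le_left _ _), (min_le_right _ _).trans (min_le_right _ _)⟩
  obtain ⟨k, ⟨⟨⟨⟨⟨J, hJ, hJp⟩, ⟨J', hJ', hJ'q⟩⟩, hηk⟩, hnk⟩, hLk⟩, hRk⟩ :=
    ((((((gl_eventually_approx hR hmatch hp hε0).and (gl_eventually_approx hR hmatch hq hε0)).and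
      (hη.eventually (eventually_lt_nhds hε0))).and
      ((gl_tendsto_norm_sub_mul hnrm 2).eventually (eventually_lt_nhds hε0))).and
      (Metric.tendsto_nhds.1 hL ε hε0)).and (hR.eventually_ge_atTop 0)).exists
  have hJ'R : dist (y k J') (y k (i₀ k)) ≤ R k := hJ'.trans (half_le_self hRk)
  have hdiff : y k J' - y k (i₀ k) - (y k J - y k (i₀ k)) = y k J' - y k J := by abel
  -- distances: `dist (y J) (y J')` is `2ε`-close to `dist p q`
  have hdJ : dist (y k J) (y k J') = dist (B (y k J - y k (i₀ k))) (B (y k J' - y k (i₀ k))) :=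
    (gl_dist_map_sub_sub B _ _ _).symm
  have hdclose : |dist (y k J) (y k J') - dist p q| ≤ 2 * ε := by
    rw [hdJ]
    have h1 := abs_dist_sub_le (B (y k J - y k (i₀ k))) p (B (y k J' - y k (i₀ k)))
    have h2 := abs_dist_sub_le (B (y k J' - y k (i₀ k))) q p
    rw [dist_comm p (B (y k J' - y k (i₀ k)))] at h1
    rw [dist_comm q p] at h2
    have h1' := abs_le.1 (h1.trans hJp)
    have h2' := abs_le.1 (h2.trans hJ'q)
    rw [abs_le]; constructor <;> linarith
  have hdc := abs_le.1 hdclose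
  have hne : J' ≠ J := by
    rintro rfl
    rw [dist_self] at hdclose
    have := abs_le.1 hdclose
    linarith
  have hd1 : dist (y k J) (y k J') ≤ 1 := by linarith
  -- heights: the offset along `nrm k` is `3ε`-small, hence `< 19/25 - 2η`
  have hh := gl_abs_height_sub_sub_inner_le hB (nrm k) (y k J' - y k (i₀ k)) (y k J - y k (i₀ k))
  rw [hdiff] at hh
  have herr : ‖y k J' - y k J‖ * ‖nlim - nrm k‖ ≤ ε :=
    calc ‖y k J' - y k J‖ * ‖nlim - nrm k‖ ≤ 2 * ‖nlim - nrm k‖ := by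
          refine mul_le_mul_of_nonneg_right ?_ (norm_nonneg _)
          rw [← dist_eq_norm, dist_comm]; linarith
      _ = ‖nrm k - nlim‖ * 2 := by rw [norm_sub_rev, mul_comm]
      _ ≤ ε := hnk.le
  have h1 := abs_le.1 ((gl_coord_sub_le_dist (B (y k J - y k (i₀ k))) p 2).trans hJp)
  have h2 := abs_le.1 ((gl_coord_sub_le_dist (B (y k J' - y k (i₀ k))) q 2).trans hJ'q)
  have h3 := abs_le.1 (hh.trans herr)
  have hI : |inner ℝ (y k J' - y k J) (nrm k)| < 19 / 25 - 2 * η k := by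
    have : |inner ℝ (y k J' - y k J) (nrm k)| ≤ 3 * ε := by
      rw [abs_le]; constructor <;> linarith
    linarith
  have hsharp := abs_le.1 (hsharpW k J J' hJ hJ'R hne hd1 hI)
  have hLk' : |L k - Llim| < ε := by rwa [← Real.dist_eq]
  have hL2 := abs_lt.1 hLk'
  rw [Real.dist_eq, abs_le]
  constructor <;> linarith

end Summit.AtomisticToContinuum.Crystallization.Theorems.PeriodicWindowsSketch

end
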